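import Summits.BirchSwinnertonDyer.BirchSwinnertonDyer.Theorems.EisensteinPrimesTwistDeformationShapiroEval
import Literature.NumberTheory.GaloisRepresentations.DecompositionGroupOfCompletion
import HarnessLib

/-!
# Route `EisensteinPrimes` (rung K5), crux 2 `GoodLatticeBDPValue`, line `halves` v7, stub
# `stub_shapiroBridgePure` (K-Sh), brick E3: the Shapiro evaluation `sh ξ` is UNRAMIFIED at every
# place of `K̃_∞` above a finite `w ∉ S`, and above every `w ∈ S` where `loc_w ξ = 0`
# (helper for stmt-BirchSwinnertonDyer-19032)

Cell `bsd-eis`, seat `bsd-eis-k5-c2` (gen 9); HOME/k5-c2-MEMO-9.md ADDENDUM 1, brick S5 (places outside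
`S`). For `𝐃 = twistDeformation S hS κ₁ κ₂ ρ₀` (a `Gal(K_S/K)`-module) and the Shapiro evaluation
`sh : H¹(G_{K,S}, 𝐃) → subgroupH1 (pairKer κ₁ κ₂) M` (`…TwistDeformationShapiroEval.shapiroEval`), every
conjugate `conjH1 σ (sh ξ)` (`σ ∈ Γ_K`, i.e. every place of `K̃_∞` above `w`) restricts to ZERO on the
inertia group `pairKer ⊓ I_w` when `w ∉ S`: the chosen inertia group `I_w ≤ Γ_K`
(`GreenbergSelmer.inertia`) IS the inertia group of the prime `𝔓₀ = adicCompletionPrime K w`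
(`inertia_adicCompletionPrime_eq_map_absInertia`, Neukirch II (9.6)), hence lies in `N_S`
(`inertia_le_ramificationSubgroup`), a normal subgroup killed by `Γ_K ↠ G_{K,S}`. This is the
"unramified outside `S`" half of Rubin's condition `unramifiedOutside (pairKer κ₁ κ₂) M p ∅` for the
image of the bridge. §6 (E3b): at a finite `w` where Greenberg's local condition holds
(`loc S ρ (inr w) 1 ξ = 0`, i.e. `c|_{Γ_{K_w}}` is principal in `𝐃`: `loc_oneCocycleClass_eq_zero_iff`),
every conjugate `conjH1 σ (sh ξ)` is again unramified at `w` — "evaluation at the point `κ(σ)` =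
conjugation by `σ`" (`…ShapiroCocycle.smul_apply_conj_apply_zero`). Together: for
`ξ ∈ S_{𝓛_v}(K, 𝐃)` the class `sh ξ` satisfies Rubin's unramified conditions at every finite
`w ≠ v` (the `greenbergKer` form at `v̄` and the packaging into `unrSelmer₂` are the next brick).
Theorems only; no named fact, no `sorry`. HONEST FRAMING: closes nothing by itself (`--supports`).
References: [GreenbergVatsal2000] §2 pp. 16–17; [NeukirchANT1999] Ch. II §9 (9.6);
[NeukirchSchmidtWingberg2008] VIII §3 (`G_S`).
-/

set_option autoImplicit false
set_option linter.dupNamespace false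

noncomputable section

open scoped Classical
open NumberField IsDedekindDomain Field PowerSeries
open Literature.NumberTheory.EllipticCurves Literature.NumberTheory.GaloisRepresentations
  Literature.NumberTheory.IwasawaTheory.Greenberg2006 Literature.NumberTheory.IwasawaTheory.Greenberg2016

namespace Summit.BirchSwinnertonDyer.BirchSwinnertonDyer.Theorems.GreenbergFullAtSelmer

variable {K : Type} [Field K] [NumberField K] {S : Set (HeightOneSpectrum (𝓞 K))} {p : ℕ}
  [Fact p.Prime] {𝒪 : Type} [CommRing 𝒪] [TopologicalSpace 𝒪]
  {A : Type} [AddCommGroup A] [Module 𝒪 A] [TopologicalSpace A] [DiscreteTopology A]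
  [TopologicalSpace (PowerSeries 𝒪)] [TopologicalSpace (PowerSeries (PowerSeries 𝒪))]
  [IsTopologicalAddGroup (IndModule₂ 𝒪 p A)]
  [ContinuousSMul (PowerSeries (PowerSeries 𝒪)) (IndModule₂ 𝒪 p A)]
  (hS : ∀ v : HeightOneSpectrum (𝓞 K), ((p : ℕ) : 𝓞 K) ∈ v.asIdeal → v ∈ S)
  (κ₁ κ₂ : ZpExtension K p) (ρ₀ : ContinuousRep (GaloisGroupUnramifiedOutside K S) 𝒪 A)
  {M : Type} [AddCommGroup M] [DistribMulAction (absoluteGaloisGroup K) M] [TopologicalSpace M]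
  [DiscreteTopology M]

/-! ## §5. Unramified outside `S`: every conjugate of `sh ξ` dies on the inertia groups above `w ∉ S` -/

section Unramified

variable (ψ : A →+ M)
  (hψ : ∀ (σ : absoluteGaloisGroup K) (a : A), ψ (ρ₀ (toUnramifiedQuot K S σ) a) = σ • ψ a)

omit [NumberField K] in
/-- `resH1Hom` on an explicit crossed homomorphism: `[f] ↦ [ψ' ∘ f ∘ φ]`. [cite: SerreGaloisCohomology1997, Ch. I §2.4] -/
theorem resH1Hom_oneCocycleClass {G' : Type} [Group G'] [TopologicalSpace G'] [IsTopologicalGroup G']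
    {N : Type} [AddCommGroup N] [DistribMulAction G' N] [TopologicalSpace N] [DiscreteTopology N]
    (φ : G' →ₜ* ZpExtension.pairKer κ₁ κ₂) (ψ' : M →+ N)
    (h : ∀ (x : G') (m : M), ψ' (φ x • m) = x • ψ' m)
    (f : contOneCocycles (discreteTopRep (ZpExtension.pairKer κ₁ κ₂) M)) :
    resH1Hom φ ψ' h (oneCocycleClass (discreteTopRep (ZpExtension.pairKer κ₁ κ₂) M) f) =
      oneCocycleClass (discreteTopRep G' N)
        (contOneCocycles.pullback φ (resHomOfEquivariant φ ψ' h) f) :=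
  map_oneCocycleClass _ _ _ f

/-- An element of the chosen inertia group `I_w ≤ Γ_K` at a place `w ∉ S` dies in `G_{K,S}`
(`I_w = I_{𝔓₀}`, `𝔓₀ = adicCompletionPrime K w`, lies in `N_S`), and so do its conjugates.
[cite: NeukirchSchmidtWingberg2008, VIII §3] -/
theorem toUnramifiedQuot_conj_eq_one_of_mem_inertia {w : HeightOneSpectrum (𝓞 K)} (hw : w ∉ S)
    {x : absoluteGaloisGroup K} (hx : x ∈ GreenbergSelmer.inertia w) (σ : absoluteGaloisGroup K) :
    toUnramifiedQuot K S (σ⁻¹ * x * σ) = 1 := by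
  have hx' : x ∈ (adicCompletionPrime K w).inertia (absoluteGaloisGroup K) := by
    rw [inertia_adicCompletionPrime_eq_map_absInertia]
    exact hx
  have hN : x ∈ ramificationSubgroup K S :=
    inertia_le_ramificationSubgroup hw (adicCompletionPrime_mem_primesAbove K w) hx'
  exact (QuotientGroup.eq_one_iff _).mpr
    ((inferInstance : (ramificationSubgroup K S).Normal).conj_mem' x hN σ)

/-- **`sh ξ` dies on every inertia group above a `w ∉ S`, with any coefficients**: for every
`σ ∈ Γ_K` (every place of `K̃_∞` above `w`) and every compatible coefficient map `ψ' : M → N` out of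
`M` (e.g. `id`, or Greenberg's `M ↠ M ⧸ M⁺`), the conjugate class `conjH1 σ (sh ξ)` maps to ZERO in
`H¹(pairKer ⊓ I_w, N)`: the pulled-back cocycle vanishes identically, because `I_w = I_{𝔓₀}` lies in
`N_S` (`inertia_adicCompletionPrime_eq_map_absInertia`, `inertia_le_ramificationSubgroup`).
[cite: GreenbergVatsal2000, §2 pp. 16–17] [cite: Greenberg2006, p. 341 L39–45] -/
theorem resH1Hom_inertia_conjH1_shapiroEval_eq_zero (ξ : (twistDeformation S hS κ₁ κ₂ ρ₀).H 1)
    (σ : absoluteGaloisGroup K) {w : HeightOneSpectrum (𝓞 K)} (hw : w ∉ S)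
    {N : Type} [AddCommGroup N]
    [DistribMulAction (GreenbergSelmer.inertiaIn (ZpExtension.pairKer κ₁ κ₂) w) N]
    [TopologicalSpace N] [DiscreteTopology N] (ψ' : M →+ N)
    (h' : ∀ (x : GreenbergSelmer.inertiaIn (ZpExtension.pairKer κ₁ κ₂) w) (m : M),
      ψ' (GreenbergSelmer.inertiaInToH (ZpExtension.pairKer κ₁ κ₂) w x • m) = x • ψ' m) :
    resH1Hom (GreenbergSelmer.inertiaInToH (ZpExtension.pairKer κ₁ κ₂) w) ψ' h'
      (conjH1 (ZpExtension.pairKer κ₁ κ₂) M σ (shapiroEval hS κ₁ κ₂ ρ₀ ψ hψ ξ)) = 0 := by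
  obtain ⟨c, rfl⟩ := oneCocycleClass_surjective _ ξ
  rw [shapiroEval_oneCocycleClass, conjH1_oneCocycleClass, resH1Hom_oneCocycleClass]
  refine (congrArg (oneCocycleClass _) ?_).trans (oneCocycleClass_zero _)
  apply Subtype.ext
  ext x
  have hx : ((x : GreenbergSelmer.decomp (K := K) w) : absoluteGaloisGroup K) ∈
      GreenbergSelmer.inertia w := ((GreenbergSelmer.mem_inertiaIn_iff _ w x.1).mp x.2).2
  have h1 := toUnramifiedQuot_conj_eq_one_of_mem_inertia (S := S) hw hx σ
  rw [contOneCocycles.pullback_apply, contOneCocycles.pullback_apply]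
  change ψ' (σ • ψ (c.1 (toUnramifiedQuot K S (σ⁻¹ * ((x : GreenbergSelmer.decomp (K := K) w) :
      absoluteGaloisGroup K) * σ)) 0 0)) = 0
  rw [h1, contOneCocycles.apply_one]
  change ψ' (σ • ψ ((0 : IndModule₂ 𝒪 p A) 0 0)) = 0
  rw [BigRepModule.zero_apply, BigRepModule.zero_apply, map_zero, smul_zero, map_zero]

/-- **`sh ξ` is unramified at every place of `K̃_∞` above a `w ∉ S`**: every conjugate
`conjH1 σ (sh ξ)` lies in `GreenbergVatsal2000.unramifiedKer (pairKer κ₁ κ₂) M w` (coefficients `id`).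
[cite: GreenbergVatsal2000, §2 pp. 16–17] -/
theorem conjH1_shapiroEval_mem_unramifiedKer (ξ : (twistDeformation S hS κ₁ κ₂ ρ₀).H 1)
    (σ : absoluteGaloisGroup K) {w : HeightOneSpectrum (𝓞 K)} (hw : w ∉ S) :
    conjH1 (ZpExtension.pairKer κ₁ κ₂) M σ (shapiroEval hS κ₁ κ₂ ρ₀ ψ hψ ξ) ∈
      GreenbergVatsal2000.unramifiedKer (ZpExtension.pairKer κ₁ κ₂) M w :=
  resH1Hom_inertia_conjH1_shapiroEval_eq_zero hS κ₁ κ₂ ρ₀ ψ hψ ξ σ hw (AddMonoidHom.id M)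
    fun _ _ ↦ rfl

end Unramified

/-! ## §6. Local conditions at `w ∈ S ∖ {v}`: `loc_w ξ = 0 ⇒` every conjugate of `sh ξ` is unramified at `w` -/

section Local

variable (ψ : A →+ M)
  (hψ : ∀ (σ : absoluteGaloisGroup K) (a : A), ψ (ρ₀ (toUnramifiedQuot K S σ) a) = σ • ψ a)

/-- `loc_w` on an explicit crossed homomorphism: the localisation of `[c]` at the place `w` VANISHES
iff `c` restricted to `Γ_{K_w}` (through `Γ_{K_w} → G_{K,S}`) is principal in `𝐃`.
[cite: Greenberg2016Selmer, §1 p. 3 L26–28] [cite: SerreGaloisCohomology1997, Ch. I §5.1] -/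
theorem loc_oneCocycleClass_eq_zero_iff (w : Place K)
    (c : contOneCocycles (twistDeformation S hS κ₁ κ₂ ρ₀).toTopRep) :
    loc S (twistDeformation S hS κ₁ κ₂ ρ₀) w 1
        (oneCocycleClass (twistDeformation S hS κ₁ κ₂ ρ₀).toTopRep c) = 0 ↔
      ∃ Φ : IndModule₂ 𝒪 p A, ∀ τ : absoluteGaloisGroup w.Completion,
        c.1 (localToUnramified S w τ) =
          twistDeformation S hS κ₁ κ₂ ρ₀ (localToUnramified S w τ) Φ - Φ := by
  change (ContinuousCohomology.map (localToUnramified S w)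
      (X := (twistDeformation S hS κ₁ κ₂ ρ₀).toTopRep)
      (Y := ((twistDeformation S hS κ₁ κ₂ ρ₀).restrict (localToUnramified S w)).toTopRep)
      (TopRep.ofHom ⟨ContinuousLinearMap.id _ _, fun _ ↦ rfl⟩) 1).hom
      (oneCocycleClass (twistDeformation S hS κ₁ κ₂ ρ₀).toTopRep c) = 0 ↔ _
  rw [map_oneCocycleClass, oneCocycleClass_eq_zero_iff]
  rfl

/-- **Greenberg's local condition at `w` forces Rubin's at every place above `w`**: if the
localisation of `ξ ∈ H¹(G_{K,S}, 𝐃)` at the finite place `w` vanishes (`𝓛_v` is `0` at every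
`w ∈ Σ ∖ {v}`), then for every `σ ∈ Γ_K` the conjugate `conjH1 σ (sh ξ)` restricts to ZERO in
`H¹(pairKer ⊓ I_w, M)`, i.e. lies in `unramifiedKer (pairKer κ₁ κ₂) M w` — via "evaluation at the
point `κ(σ)` of `Γ` = conjugation by `σ`" (`…ShapiroCocycle.smul_apply_conj_apply_zero`). Brick S5(⇒).
[cite: Greenberg2006, p. 342 display (2), L15–23] [cite: GreenbergVatsal2000, §2 pp. 16–17] -/
theorem resH1Hom_inertia_conjH1_shapiroEval_eq_zero_of_loc_eq_zero
    (ξ : (twistDeformation S hS κ₁ κ₂ ρ₀).H 1) {w : HeightOneSpectrum (𝓞 K)}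
    (hloc : loc S (twistDeformation S hS κ₁ κ₂ ρ₀) (Sum.inr w) 1 ξ = 0)
    (σ : absoluteGaloisGroup K)
    {N : Type} [AddCommGroup N]
    [DistribMulAction (GreenbergSelmer.inertiaIn (ZpExtension.pairKer κ₁ κ₂) w) N]
    [TopologicalSpace N] [DiscreteTopology N] (ψ' : M →+ N)
    (h' : ∀ (x : GreenbergSelmer.inertiaIn (ZpExtension.pairKer κ₁ κ₂) w) (m : M),
      ψ' (GreenbergSelmer.inertiaInToH (ZpExtension.pairKer κ₁ κ₂) w x • m) = x • ψ' m) :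
    resH1Hom (GreenbergSelmer.inertiaInToH (ZpExtension.pairKer κ₁ κ₂) w) ψ' h'
      (conjH1 (ZpExtension.pairKer κ₁ κ₂) M σ (shapiroEval hS κ₁ κ₂ ρ₀ ψ hψ ξ)) = 0 := by
  obtain ⟨c, rfl⟩ := oneCocycleClass_surjective _ ξ
  obtain ⟨Φ, hΦ⟩ := (loc_oneCocycleClass_eq_zero_iff hS κ₁ κ₂ ρ₀ (Sum.inr w) c).mp hloc
  rw [shapiroEval_oneCocycleClass, conjH1_oneCocycleClass, resH1Hom_oneCocycleClass,
    oneCocycleClass_eq_zero_iff]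
  have hc : ∀ g h : GaloisGroupUnramifiedOutside K S,
      c.1 (g * h) = c.1 g + twistDeformation S hS κ₁ κ₂ ρ₀ g (c.1 h) := c.2
  -- the coordinates of `σ` and the vector `n = Φ(a,b) + c(σ̄)(a,b)`
  set a : ℤ_[p] := (κ₁.liftUnramifiedOutside S hS (toUnramifiedQuot K S σ)).toAdd with ha
  set b : ℤ_[p] := (κ₂.liftUnramifiedOutside S hS (toUnramifiedQuot K S σ)).toAdd with hb
  refine ⟨ψ' (ψ (Φ a b + c.1 (toUnramifiedQuot K S σ) a b)), fun x ↦ ?_⟩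
  have hx := (GreenbergSelmer.mem_inertiaIn_iff _ w x.1).mp x.2
  have hxH := ZpExtension.mem_pairKer_iff.mp hx.1
  obtain ⟨τ, hτ⟩ := MonoidHom.mem_range.mp (x.1 : GreenbergSelmer.decomp (K := K) w).2
  -- `c(x̄) = ∂Φ(x̄)` from the local triviality
  have hcx : c.1 (toUnramifiedQuot K S ((x.1 : GreenbergSelmer.decomp (K := K) w) :
      absoluteGaloisGroup K)) =
      twistDeformation S hS κ₁ κ₂ ρ₀ (toUnramifiedQuot K S ((x.1 : GreenbergSelmer.decomp (K := K) w) :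
        absoluteGaloisGroup K)) Φ - Φ := by
    have := hΦ τ
    rwa [show localToUnramified S (Sum.inr w : Place K) τ = toUnramifiedQuot K S
      ((x.1 : GreenbergSelmer.decomp (K := K) w) : absoluteGaloisGroup K) by rw [← hτ]; rfl] at this
  have key := smul_apply_conj_apply_zero hS κ₁ κ₂ ρ₀ c.1 hc (toUnramifiedQuot K S σ)
    (toUnramifiedQuot K S ((x.1 : GreenbergSelmer.decomp (K := K) w) : absoluteGaloisGroup K))
    hxH.1 hxH.2
  have hconj : toUnramifiedQuot K S (σ⁻¹ * ((x.1 : GreenbergSelmer.decomp (K := K) w) :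
      absoluteGaloisGroup K) * σ) = (toUnramifiedQuot K S σ)⁻¹ *
        toUnramifiedQuot K S ((x.1 : GreenbergSelmer.decomp (K := K) w) : absoluteGaloisGroup K) *
          toUnramifiedQuot K S σ := by
    rw [map_mul, map_mul, map_inv]
  have h1 : κ₁.liftUnramifiedOutside S hS (toUnramifiedQuot K S
      ((x.1 : GreenbergSelmer.decomp (K := K) w) : absoluteGaloisGroup K)) = 1 := hxH.1
  have h2 : κ₂.liftUnramifiedOutside S hS (toUnramifiedQuot K S
      ((x.1 : GreenbergSelmer.decomp (K := K) w) : absoluteGaloisGroup K)) = 1 := hxH.2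
  rw [contOneCocycles.pullback_apply, contOneCocycles.pullback_apply]
  change ψ' (σ • ψ (c.1 (toUnramifiedQuot K S (σ⁻¹ * ((x.1 : GreenbergSelmer.decomp (K := K) w) :
      absoluteGaloisGroup K) * σ)) 0 0)) =
    x • ψ' (ψ (Φ a b + c.1 (toUnramifiedQuot K S σ) a b)) -
      ψ' (ψ (Φ a b + c.1 (toUnramifiedQuot K S σ) a b))
  rw [← h', ← map_sub ψ']
  congr 1
  change _ = ((x.1 : GreenbergSelmer.decomp (K := K) w) : absoluteGaloisGroup K) •
        ψ (Φ a b + c.1 (toUnramifiedQuot K S σ) a b) - ψ (Φ a b + c.1 (toUnramifiedQuot K S σ) a b)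
  rw [hconj, ← hψ, key, hcx, BigRepModule.sub_apply, BigRepModule.sub_apply, twistDeformation_apply,
    h1, h2, ← hψ, ← map_sub ψ]
  congr 1
  simp only [toAdd_one, sub_zero, map_add]
  abel

/-- **Greenberg's local condition at `w` forces Rubin's unramified condition at every place above
`w`** (coefficients `id`): `loc_w ξ = 0 ⇒ conjH1 σ (sh ξ) ∈ unramifiedKer (pairKer κ₁ κ₂) M w`.
[cite: Greenberg2006, p. 342 display (2), L15–23] [cite: GreenbergVatsal2000, §2 pp. 16–17] -/
theorem conjH1_shapiroEval_mem_unramifiedKer_of_loc_eq_zero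
    (ξ : (twistDeformation S hS κ₁ κ₂ ρ₀).H 1) {w : HeightOneSpectrum (𝓞 K)}
    (hloc : loc S (twistDeformation S hS κ₁ κ₂ ρ₀) (Sum.inr w) 1 ξ = 0)
    (σ : absoluteGaloisGroup K) :
    conjH1 (ZpExtension.pairKer κ₁ κ₂) M σ (shapiroEval hS κ₁ κ₂ ρ₀ ψ hψ ξ) ∈
      GreenbergVatsal2000.unramifiedKer (ZpExtension.pairKer κ₁ κ₂) M w :=
  resH1Hom_inertia_conjH1_shapiroEval_eq_zero_of_loc_eq_zero hS κ₁ κ₂ ρ₀ ψ hψ ξ hloc σ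
    (AddMonoidHom.id M) fun _ _ ↦ rfl



end Local

end Summit.BirchSwinnertonDyer.BirchSwinnertonDyer.Theorems.GreenbergFullAtSelmer

end
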